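import Summits.AnomalousDissipation.AnomalousDissipation.Theorems.MomentParityQuarticGateModeCalculus
import Summits.AnomalousDissipation.AnomalousDissipation.Theorems.MomentParityQuarticGateAtomRows

/-!
# Stress packets: the phase-averaged Reynolds stress of a two-mode packet

Helper file for stub S5 (`stub_balancedMenu`) of the line `farkas-split-menu` of crux
`MomentParity.CubicParityLoud` (stmt-AnomalousDissipation-11465). A STRESS PACKET at the wavevectors
`k`, `k + q` with amplitudes `x ⊥ k`, `y ⊥ k, q` is the pair of real coefficient families
`A = (δ_k x + δ_{-k} x̄) + (δ_{k+q} y + δ_{-(k+q)} ȳ)` and `B =` the same with `(x, y) ↦ (ix, iy)`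
(a quarter-turn of the common phase). Entering an atom with two INDEPENDENT random signs, the
pair contributes to the sign-averaged convection symbol exactly
`convectionCoeff A A + convectionCoeff B B = δ_q z + δ_{-q} z̄`, `z = (4πi (x̄ · q)) • y`:
the self-interactions at `±(2k + q)` cancel between `A` and `B` (`i² = -1`), and what survives is
the momentum-`±q` REYNOLDS STRESS of the packet (pure coefficient algebra on
`Torus.convectionCoeff`, `convectionCoeff_single_single`). Also here: conjugate symmetry and
transversality of `A`, `B`, and the additivity over disjointly supported families of sums
`∑_κ F κ (c κ)` (energy, enstrophy and helicity weights of a packet split over its two pairs).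
-/

namespace Summit.AnomalousDissipation.AnomalousDissipation.Theorems.MomentParityCubicParityLoud

open Finset Complex
open scoped ComplexConjugate
open Literature.Analysis.FunctionSpaces Literature.Analysis.FluidPDE
open Summit.AnomalousDissipation.AnomalousDissipation.Theorems.MomentParityQuarticGate

set_option linter.dupNamespace false

section Cancel

variable (S : Finset (Fin 3 → ℤ))

/-- **Quarter-turn cancellation**: for the quadratic convection symbol `Q(c) = convectionCoeff S c c`,
`Q(P + P') + Q(iP - iP') = 2 (convectionCoeff S P P' + convectionCoeff S P' P)` — the squares
`Q(P)`, `Q(P')` cancel (`i² = -1`), the mixed terms double. [folklore] -/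
theorem convectionCoeff_quarter_turn_cancel (P P' : (Fin 3 → ℤ) → EuclideanSpace ℂ (Fin 3)) (κ : Fin 3 → ℤ) :
    Torus.convectionCoeff S (P + P') (P + P') κ +
        Torus.convectionCoeff S (I • P + (-I) • P') (I • P + (-I) • P') κ =
      (2 : ℂ) • (Torus.convectionCoeff S P P' κ + Torus.convectionCoeff S P' P κ) := by
  simp only [Torus.convectionCoeff_add_left, Torus.convectionCoeff_add_right, Torus.convectionCoeff_smul_left,
    Torus.convectionCoeff_smul_right, smul_add, smul_smul, mul_neg, neg_mul, Complex.I_mul_I, neg_neg, one_smul,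
    neg_one_smul, two_smul]
  abel

end Cancel

section Packet

variable (S : Finset (Fin 3 → ℤ)) (k q : Fin 3 → ℤ) (x y : EuclideanSpace ℂ (Fin 3))

/-- The packet family `A` is the sum of its positive-frequency half and the conjugate half. [folklore] -/
theorem packet_eq_half_add_half :
    ((Pi.single k x + Pi.single (-k) (EuclideanSpace.conjVec x)) +
        (Pi.single (k + q) y + Pi.single (-(k + q)) (EuclideanSpace.conjVec y)) :
          (Fin 3 → ℤ) → EuclideanSpace ℂ (Fin 3)) =
      (Pi.single k x + Pi.single (k + q) y) +
        (Pi.single (-k) (EuclideanSpace.conjVec x) + Pi.single (-(k + q)) (EuclideanSpace.conjVec y)) := by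
  abel

/-- The quarter-turned packet family `B` is `i • (positive half) + (-i) • (conjugate half)`. [folklore] -/
theorem packet_I_eq_half_sub_half :
    ((Pi.single k (I • x) + Pi.single (-k) (EuclideanSpace.conjVec (I • x))) +
        (Pi.single (k + q) (I • y) + Pi.single (-(k + q)) (EuclideanSpace.conjVec (I • y))) :
          (Fin 3 → ℤ) → EuclideanSpace ℂ (Fin 3)) =
      I • (Pi.single k x + Pi.single (k + q) y : (Fin 3 → ℤ) → EuclideanSpace ℂ (Fin 3)) +
        (-I) • (Pi.single (-k) (EuclideanSpace.conjVec x) + Pi.single (-(k + q)) (EuclideanSpace.conjVec y)) := by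
  rw [EuclideanSpace.conjVec_smul, EuclideanSpace.conjVec_smul, Complex.conj_I, smul_add, smul_add,
    Pi.single_smul, Pi.single_smul, Pi.single_smul, Pi.single_smul]
  abel

variable {S k q x y}

/-- **The mixed convection terms of a packet** (positive half against conjugate half and back):
only the momentum-`±q` interactions survive transversality (`x ⊥ k`, `y ⊥ k`, `y ⊥ q`), giving
`δ_q ((2πi x̄·q) • y) + δ_{-q} ((-2πi x·q) • ȳ)`. [folklore] -/
theorem convectionCoeff_half_half (hk : k ∈ S) (hkq : k + q ∈ S) (hnk : -k ∈ S) (hnkq : -(k + q) ∈ S)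
    (hxk : ∑ j, (k j : ℂ) * x j = 0) (hyk : ∑ j, (k j : ℂ) * y j = 0) (hyq : ∑ j, (q j : ℂ) * y j = 0)
    (κ : Fin 3 → ℤ) :
    Torus.convectionCoeff S (Pi.single k x + Pi.single (k + q) y)
        (Pi.single (-k) (EuclideanSpace.conjVec x) + Pi.single (-(k + q)) (EuclideanSpace.conjVec y)) κ +
      Torus.convectionCoeff S (Pi.single (-k) (EuclideanSpace.conjVec x) + Pi.single (-(k + q)) (EuclideanSpace.conjVec y))
        (Pi.single k x + Pi.single (k + q) y) κ =
      (if q = κ then (2 * Real.pi * I * ∑ j, conj (x j) * (q j : ℂ)) • y else 0) +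
        (if -q = κ then (-(2 * Real.pi * I * ∑ j, x j * (q j : ℂ))) • EuclideanSpace.conjVec y else 0) := by
  have hx0 : ∑ j, x j * (k j : ℂ) = 0 := by rw [← hxk]; exact Finset.sum_congr rfl fun j _ => mul_comm _ _
  have hy0 : ∑ j, y j * (k j : ℂ) = 0 := by rw [← hyk]; exact Finset.sum_congr rfl fun j _ => mul_comm _ _
  have hy0' : ∑ j, y j * (q j : ℂ) = 0 := by rw [← hyq]; exact Finset.sum_congr rfl fun j _ => mul_comm _ _
  have hx1 : ∑ j, x j * ((-k) j : ℂ) = 0 := by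
    simp only [Pi.neg_apply, Int.cast_neg, mul_neg, Finset.sum_neg_distrib, hx0, neg_zero]
  have hx2 : ∑ j, x j * ((-(k + q)) j : ℂ) = -∑ j, x j * (q j : ℂ) := by
    simp only [Pi.neg_apply, Pi.add_apply, Int.cast_neg, Int.cast_add, mul_neg, mul_add, Finset.sum_neg_distrib,
      Finset.sum_add_distrib, hx0, zero_add]
  have hy1 : ∑ j, y j * ((-k) j : ℂ) = 0 := by
    simp only [Pi.neg_apply, Int.cast_neg, mul_neg, Finset.sum_neg_distrib, hy0, neg_zero]
  have hy2 : ∑ j, y j * ((-(k + q)) j : ℂ) = 0 := by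
    simp only [Pi.neg_apply, Pi.add_apply, Int.cast_neg, Int.cast_add, mul_neg, mul_add, Finset.sum_neg_distrib,
      Finset.sum_add_distrib, hy0, hy0', add_zero, neg_zero]
  have hconj : ∀ (z : EuclideanSpace ℂ (Fin 3)) (m : Fin 3 → ℤ),
      ∑ j, EuclideanSpace.conjVec z j * (m j : ℂ) = conj (∑ j, z j * (m j : ℂ)) := fun z m => by
    rw [map_sum]
    exact Finset.sum_congr rfl fun j _ => by simp [EuclideanSpace.conjVec_apply]
  have hxb1 : ∑ j, EuclideanSpace.conjVec x j * (k j : ℂ) = 0 := by rw [hconj, hx0, map_zero]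
  have hxb2 : ∑ j, EuclideanSpace.conjVec x j * ((k + q) j : ℂ) = ∑ j, conj (x j) * (q j : ℂ) := by
    rw [hconj]
    simp only [Pi.add_apply, Int.cast_add, mul_add, Finset.sum_add_distrib, hx0, zero_add, map_sum, map_mul,
      map_intCast]
  have hyb1 : ∑ j, EuclideanSpace.conjVec y j * (k j : ℂ) = 0 := by rw [hconj, hy0, map_zero]
  have hyb2 : ∑ j, EuclideanSpace.conjVec y j * ((k + q) j : ℂ) = 0 := by
    rw [hconj]
    simp only [Pi.add_apply, Int.cast_add, mul_add, Finset.sum_add_distrib, hy0, hy0', add_zero, map_zero]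
  rw [Torus.convectionCoeff_add_left, Torus.convectionCoeff_add_right, Torus.convectionCoeff_add_right,
    Torus.convectionCoeff_add_left, Torus.convectionCoeff_add_right, Torus.convectionCoeff_add_right,
    convectionCoeff_single_single_eq_zero S k hx1, convectionCoeff_single_single hk hnkq,
    convectionCoeff_single_single_eq_zero S (k + q) hy1, convectionCoeff_single_single_eq_zero S (k + q) hy2,
    convectionCoeff_single_single_eq_zero S (-k) hxb1, convectionCoeff_single_single hnk hkq,
    convectionCoeff_single_single_eq_zero S (-(k + q)) hyb1,
    convectionCoeff_single_single_eq_zero S (-(k + q)) hyb2, hx2, hxb2]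
  simp only [Pi.zero_apply, zero_add, add_zero]
  have h1 : k + -(k + q) = -q := by abel
  have h2 : -k + (k + q) = q := by abel
  rw [h1, h2, add_comm]
  congr 1
  split_ifs <;> simp

/-- **THE PACKET STRESS**: with two independent signs on `A` and on its quarter-turn `B`, the
sign-averaged convection symbol of the packet is the mode pair
`convectionCoeff A A + convectionCoeff B B = δ_q z + δ_{-q} z̄`, `z = (4πi ∑ⱼ x̄ⱼ qⱼ) • y`
(the `±(2k+q)` self-interactions cancel; hypotheses: the four packet frequencies lie in `S`,
`x ⊥ k`, `y ⊥ k`, `y ⊥ q`). [folklore] -/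
theorem packet_stress (hk : k ∈ S) (hkq : k + q ∈ S) (hnk : -k ∈ S) (hnkq : -(k + q) ∈ S)
    (hxk : ∑ j, (k j : ℂ) * x j = 0) (hyk : ∑ j, (k j : ℂ) * y j = 0) (hyq : ∑ j, (q j : ℂ) * y j = 0) :
    Torus.convectionCoeff S
        ((Pi.single k x + Pi.single (-k) (EuclideanSpace.conjVec x)) +
          (Pi.single (k + q) y + Pi.single (-(k + q)) (EuclideanSpace.conjVec y)))
        ((Pi.single k x + Pi.single (-k) (EuclideanSpace.conjVec x)) +
          (Pi.single (k + q) y + Pi.single (-(k + q)) (EuclideanSpace.conjVec y))) +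
      Torus.convectionCoeff S
        ((Pi.single k (I • x) + Pi.single (-k) (EuclideanSpace.conjVec (I • x))) +
          (Pi.single (k + q) (I • y) + Pi.single (-(k + q)) (EuclideanSpace.conjVec (I • y))))
        ((Pi.single k (I • x) + Pi.single (-k) (EuclideanSpace.conjVec (I • x))) +
          (Pi.single (k + q) (I • y) + Pi.single (-(k + q)) (EuclideanSpace.conjVec (I • y)))) =
      (Pi.single q ((4 * Real.pi * I * ∑ j, conj (x j) * (q j : ℂ)) • y) +
        Pi.single (-q) (EuclideanSpace.conjVec ((4 * Real.pi * I * ∑ j, conj (x j) * (q j : ℂ)) • y)) :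
          (Fin 3 → ℤ) → EuclideanSpace ℂ (Fin 3)) := by
  funext κ
  rw [packet_eq_half_add_half, packet_I_eq_half_sub_half, Pi.add_apply, convectionCoeff_quarter_turn_cancel,
    convectionCoeff_half_half hk hkq hnk hnkq hxk hyk hyq, Pi.add_apply, Pi.single_apply, Pi.single_apply,
    smul_add, EuclideanSpace.conjVec_smul]
  have hc : conj (4 * Real.pi * I * ∑ j, conj (x j) * (q j : ℂ)) = -(4 * Real.pi * I * ∑ j, x j * (q j : ℂ)) := by
    simp only [map_mul, map_sum, map_ofNat, Complex.conj_ofReal, Complex.conj_I, Complex.conj_conj, map_intCast]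
    ring
  rw [hc]
  congr 1
  · by_cases h : κ = q
    · subst h; simp only [if_true, smul_smul]; congr 1; ring
    · rw [if_neg h, if_neg (Ne.symm h), smul_zero]
  · by_cases h : κ = -q
    · subst h; simp only [if_true, smul_smul]; congr 1; ring
    · rw [if_neg h, if_neg (Ne.symm h), smul_zero]

/-- Transversality of a polarised amplitude is preserved by complex scaling. [folklore] -/
theorem sum_mul_smul_eq_zero {m : Fin 3 → ℤ} {z : EuclideanSpace ℂ (Fin 3)} (a : ℂ)
    (h : ∑ j, (m j : ℂ) * z j = 0) : ∑ j, (m j : ℂ) * (a • z) j = 0 := by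
  simp only [PiLp.smul_apply, smul_eq_mul]
  calc ∑ j, (m j : ℂ) * (a * z j) = a * ∑ j, (m j : ℂ) * z j := by
        rw [Finset.mul_sum]; exact Finset.sum_congr rfl fun j _ => by ring
    _ = 0 := by rw [h, mul_zero]

/-- `y ⊥ k` and `y ⊥ q` give `y ⊥ k + q`. [folklore] -/
theorem sum_add_mul_eq_zero {k q : Fin 3 → ℤ} {y : EuclideanSpace ℂ (Fin 3)}
    (hyk : ∑ j, (k j : ℂ) * y j = 0) (hyq : ∑ j, (q j : ℂ) * y j = 0) :
    ∑ j, ((k + q) j : ℂ) * y j = 0 := by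
  simp only [Pi.add_apply, Int.cast_add, add_mul, Finset.sum_add_distrib, hyk, hyq, add_zero]

end Packet

/-! ## Sums over disjointly supported families -/

section Disjoint

/-- **Additivity of `∑_κ F κ (c κ)` over disjointly supported families** (`F κ 0 = 0`). [folklore] -/
theorem sum_apply_add_of_disjoint {M : Type*} [AddCommMonoid M] (S : Finset (Fin 3 → ℤ))
    (F : (Fin 3 → ℤ) → EuclideanSpace ℂ (Fin 3) → M) (hF : ∀ κ, F κ 0 = 0)
    {a b : (Fin 3 → ℤ) → EuclideanSpace ℂ (Fin 3)} (hab : ∀ κ, a κ = 0 ∨ b κ = 0) :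
    ∑ κ ∈ S, F κ ((a + b) κ) = ∑ κ ∈ S, F κ (a κ) + ∑ κ ∈ S, F κ (b κ) := by
  rw [← Finset.sum_add_distrib]
  refine Finset.sum_congr rfl fun κ _ => ?_
  rcases hab κ with h | h <;> simp [h, hF]

/-- The two mode pairs of a packet have disjoint supports when `q ≠ 0` and `2k + q ≠ 0`. [folklore] -/
theorem pair_disjoint_pair {k q : Fin 3 → ℤ} (hq : q ≠ 0) (h2kq : 2 • k + q ≠ 0)
    (x y : EuclideanSpace ℂ (Fin 3)) (κ : Fin 3 → ℤ) :
    (Pi.single k x + Pi.single (-k) (EuclideanSpace.conjVec x) : (Fin 3 → ℤ) → EuclideanSpace ℂ (Fin 3)) κ = 0 ∨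
      (Pi.single (k + q) y + Pi.single (-(k + q)) (EuclideanSpace.conjVec y) :
        (Fin 3 → ℤ) → EuclideanSpace ℂ (Fin 3)) κ = 0 := by
  by_cases h1 : κ = k
  · subst h1
    refine Or.inr ?_
    have ha : κ ≠ κ + q := fun h => hq (by simpa using h.symm)
    have hb : κ ≠ -(κ + q) := fun h => h2kq (by rw [two_smul]; nth_rewrite 1 [h]; abel)
    rw [Pi.add_apply, Pi.single_eq_of_ne ha, Pi.single_eq_of_ne hb, add_zero]
  · by_cases h2 : κ = -k
    · subst h2
      refine Or.inr ?_
      have ha : -k ≠ k + q := fun h => h2kq (by rw [two_smul]; linear_combination (exp := 1) h.symm)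
      have hb : -k ≠ -(k + q) := fun h => hq (by have := neg_injective h; simpa using this.symm)
      rw [Pi.add_apply, Pi.single_eq_of_ne ha, Pi.single_eq_of_ne hb, add_zero]
    · exact Or.inl (by rw [Pi.add_apply, Pi.single_eq_of_ne h1, Pi.single_eq_of_ne h2, add_zero])

end Disjoint

/-- **Registered sub-goal `balancedMenu_packetStress` of stub S5 `stub_balancedMenu`** (summary of this
file): the sign-averaged convection symbol of a stress packet and its quarter-turn is the mode pair
`δ_q z + δ_{-q} z̄`, `z = (4πi ∑ⱼ x̄ⱼ qⱼ) • y`. [folklore] -/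
theorem balancedMenu_packetStress : ∀ (S : Finset (Fin 3 → ℤ)) (k q : Fin 3 → ℤ) (x y : EuclideanSpace ℂ (Fin 3)), k ∈ S → k + q ∈ S → -k ∈ S → -(k + q) ∈ S → ∑ j, (k j : ℂ) * x j = 0 → ∑ j, (k j : ℂ) * y j = 0 → ∑ j, (q j : ℂ) * y j = 0 → Torus.convectionCoeff S ((Pi.single k x + Pi.single (-k) (EuclideanSpace.conjVec x)) + (Pi.single (k + q) y + Pi.single (-(k + q)) (EuclideanSpace.conjVec y))) ((Pi.single k x + Pi.single (-k) (EuclideanSpace.conjVec x)) + (Pi.single (k + q) y + Pi.single (-(k + q)) (EuclideanSpace.conjVec y))) + Torus.convectionCoeff S ((Pi.single k (Complex.I • x) + Pi.single (-k) (EuclideanSpace.conjVec (Complex.I • x))) + (Pi.single (k + q) (Complex.I • y) + Pi.single (-(k + q)) (EuclideanSpace.conjVec (Complex.I • y)))) ((Pi.single k (Complex.I • x) + Pi.single (-k) (EuclideanSpace.conjVec (Complex.I • x))) + (Pi.single (k + q) (Complex.I • y) + Pi.single (-(k + q)) (EuclideanSpace.conjVec (Complex.I • y)))) = (Pi.single q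 ((4 * Real.pi * Complex.I * ∑ j, (starRingEnd ℂ) (x j) * (q j : ℂ)) • y) + Pi.single (-q) (EuclideanSpace.conjVec ((4 * Real.pi * Complex.I * ∑ j, (starRingEnd ℂ) (x j) * (q j : ℂ)) • y)) : (Fin 3 → ℤ) → EuclideanSpace ℂ (Fin 3)) :=
  fun _ _ _ _ _ hk hkq hnk hnkq hxk hyk hyq => packet_stress hk hkq hnk hnkq hxk hyk hyq

end Summit.AnomalousDissipation.AnomalousDissipation.Theorems.MomentParityCubicParityLoud
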